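import Literature.NumberTheory.EllipticCurves.SelmerLocalConditionUnramifiedUniform
import Literature.NumberTheory.Automorphic.AdicCompletionDegreeOnePlaceEquiv
import HarnessLib

/-!
# `E(K_w)_tors` is finite at a place of DEGREE ONE of a number field, and the uniform Selmer
# multiplier at such a place

`Proofs`-style file (theorems only: no definition, no named fact, no `sorry`) in topic
`NumberTheory/EllipticCurves`, sequel of `SelmerLocalConditionUnramifiedUniform.lean`.  There the
uniform exponent `#E(K_v)_tors` for unramified classes was made unconditional over `ℚ` only (Silverman
AEC VII.6.3 is in the tree for `ℚ_p`).  Here: for a number field `K` and a finite place `w` of `K`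
of DEGREE ONE over the place `v` of `ℚ` below it (`e(w|v) = f(w|v) = 1`, e.g. every place above a
prime that splits completely — in an imaginary quadratic field, every place above a split prime),
`K_w ≅ ℚ_v ≅ ℚ_p` (the tree's `Automorphic.adicCompletionEquivOfDegreeOne`, Mathlib's
`Rat.HeightOneSpectrum.adicCompletion.padicEquiv`), so `E(K_w)_tors` is finite by transport of
`finite_addTorsion_point_padic`, and the uniform multiplier follows
(`exists_nsmul_mem_selmerLocalKer_of_unramified_of_finite`).  Written for cell `bsd-cn100` (the
auxiliary Heegner fields `K` of routes `CongruentShaFreeCut` / `MordellShaFreeCut` have `2` resp. `3`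
split); nothing about BSD is claimed.

## References

* [SilvermanAEC2009] J. H. Silverman, *AEC*, Prop. VII.6.3.
* [FrohlichTaylor1990] A. Fröhlich, M. J. Taylor, *Algebraic Number Theory*, Ch. III §1 (1.14)(a)
  (`[K_w : ℚ_v] = e f`).
* [MilneADT2006] J. S. Milne, *Arithmetic Duality Theorems*, Ch. I §2 Lemma 2.10.
-/

noncomputable section

open scoped Classical
open NumberField IsDedekindDomain Field
open Literature.NumberTheory.EllipticCurves Literature.NumberTheory.GaloisRepresentations
open Literature.NumberTheory.Automorphic

universe u

namespace WeierstrassCurve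

variable {K : Type} [Field K] [NumberField K]

/-- **`E(K_w)_tors` is finite at a place `w` of degree one** over the place `v` of `ℚ` below it
(`e(w|v) = f(w|v) = 1`): transport of `finite_addTorsion_point_padic` (AEC VII.6.3 over `ℚ_p`) along
`K_w ≅ ℚ_v ≅ ℚ_p` (`adicCompletionEquivOfDegreeOne`, `Rat.HeightOneSpectrum.adicCompletion.padicEquiv`),
which induces an injective homomorphism on points. [cite: SilvermanAEC2009, Prop. VII.6.3]
[cite: FrohlichTaylor1990, Ch. III §1 (1.14)(a)] -/
theorem finite_addTorsion_point_adicCompletion_of_degree_one (W : WeierstrassCurve K) [W.IsElliptic]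
    (v : HeightOneSpectrum (𝓞 ℚ)) (w : HeightOneSpectrum (𝓞 K)) [w.asIdeal.LiesOver v.asIdeal]
    (he : w.asIdeal.ramificationIdx (𝓞 ℚ) = 1) (hf : w.asIdeal.inertiaDeg (𝓞 ℚ) = 1) :
    Finite (AddCommGroup.torsion (W.baseChange (w.adicCompletion K)).toAffine.Point) := by
  set ℓ : Nat.Primes := Rat.HeightOneSpectrum.primesEquiv (R := 𝓞 ℚ) v with hℓ
  haveI : Fact (ℓ : ℕ).Prime := ⟨ℓ.2⟩
  -- `K_w → ℚ_v → ℚ_ℓ`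
  let φ : w.adicCompletion K →+* ℚ_[ℓ] :=
    ((Rat.HeightOneSpectrum.adicCompletion.padicEquiv (R := 𝓞 ℚ) v).toRingEquiv.toRingHom).comp
      (adicCompletionEquivOfDegreeOne ℚ K v w he hf).symm.toRingHom
  letI : Algebra K ℚ_[ℓ] := (φ.comp (algebraMap K (w.adicCompletion K))).toAlgebra
  let φa : w.adicCompletion K →ₐ[K] ℚ_[ℓ] :=
    { φ with commutes' := fun _ => rfl }
  let f : (W.baseChange (w.adicCompletion K)).toAffine.Point →+ (W.baseChange ℚ_[ℓ]).toAffine.Point :=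
    Affine.Point.map φa
  have hfi : Function.Injective f := Affine.Point.map_injective (W' := W) φa
  haveI : Finite (AddCommGroup.torsion (W.baseChange ℚ_[ℓ]).toAffine.Point) :=
    finite_addTorsion_point_padic (W.baseChange ℚ_[ℓ])
  refine Finite.of_injective
    (fun x : AddCommGroup.torsion (W.baseChange (w.adicCompletion K)).toAffine.Point =>
      (⟨f x, f.isOfFinAddOrder x.2⟩ : AddCommGroup.torsion (W.baseChange ℚ_[ℓ]).toAffine.Point))
    fun x y hxy => ?_
  exact Subtype.ext (hfi (congrArg Subtype.val hxy))

/-- **Uniform Selmer multiplier at a degree-one place of a number field, unconditionally**: for an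
elliptic curve `E = W` over a number field `K` and a finite place `w` of degree one over `ℚ`, there is
`t ≠ 0` with `t • c ∈ selmerLocalKer W K_w n` for every `n ≠ 0` and every `c ∈ H¹(K, E[n])`
unramified at the primes above `w`. [cite: MilneADT2006, Ch. I §2 Lemma 2.10]
[cite: SilvermanAEC2009, Prop. VII.6.3] -/
theorem exists_nsmul_mem_selmerLocalKer_of_unramified_of_degree_one (W : WeierstrassCurve K)
    [W.IsElliptic] (v : HeightOneSpectrum (𝓞 ℚ)) (w : HeightOneSpectrum (𝓞 K))
    [w.asIdeal.LiesOver v.asIdeal] (he : w.asIdeal.ramificationIdx (𝓞 ℚ) = 1)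
    (hf : w.asIdeal.inertiaDeg (𝓞 ℚ) = 1) :
    ∃ t : ℕ, t ≠ 0 ∧ ∀ (n : ℤ), n ≠ 0 → ∀ c : galH1Torsion W n,
      (∀ 𝔓 ∈ w.primesAbove, c ∈ unramifiedKer (geomTorsion W n) 𝔓) →
        t • c ∈ selmerLocalKer W (w.adicCompletion K) n := by
  haveI := W.finite_addTorsion_point_adicCompletion_of_degree_one v w he hf
  exact W.exists_nsmul_mem_selmerLocalKer_of_unramified_of_finite w

end WeierstrassCurve

end
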